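import Summits.Ventures.AbcSig.Conjectures.LevelRaising32L2
import Summits.Ventures.AbcSig.Conjectures.KrausTableRefines
import Summits.Ventures.AbcSig.Levels.N352
import Summits.Ventures.AbcSig.Levels.N416
import Summits.Ventures.AbcSig.Levels.N608
import Summits.Ventures.AbcSig.Levels.N928

/-!
# Venture AbcSig — kernel-checked LEVEL SLICES of the conjecture `CONJ_LR32_L2` at `ℓ ∈ {11, 13, 19, 29}`

HONEST FRAMING. Support file of the computation cell `pub-abcsig`. `CONJ_LR32_L2` (`Conjectures/LevelRaising32L2.lean`,
p490111) is a CONJECTURE over the cell's abstract `NewformModel`; this file does NOT prove it and adds no evidence for its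
content. What is proved here: (1) the conjecture is the conjunction over primes `ℓ ≥ 3` of its level slices `CONJ_LR32_L2At M ℓ`
(bookkeeping, `CONJ_LR32_L2_iff`); (2) the premise of every slice — "`f` passes the coarse [BS04, Lemma 4.2] sets and one Kraus
class table modulo a prime above `n`" — implies the plain coarse premise `M.ArisesMod f n bs04Allowed` (by
`krausTable_subset_bs04Allowed`, `Conjectures/KrausTableRefines.lean`), so a slice holds in any model in which no newform of
level `2⁵ℓ` passes the coarse sieve at the exponents `n ≥ 17`, `n ≠ ℓ` (`CONJ_LR32_L2At_of_eliminated`); (3) the four slices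
`ℓ = 11, 13, 19, 29` (levels `352, 416, 608, 928`) hold in EVERY model whose level-`2⁵ℓ` newforms are the cell's certified orbits
— i.e. modulo the COMPUTED hypothesis `NewformModel.DataComplete` of the level files `Levels/N352.lean`, `N416`, `N608`, `N928`
(engine-1 modular symbols + p1-msgf second engine, trace-formula certificate AGREE-STURM) and NOTHING ELSE (no cited package is
used). They hold VACUOUSLY: at these four levels the kernel sieve certificates leave the residual exponent sets `⊆ {7}`, so at
every prime `n ≥ 11` no newform passes even the coarse sieve and the slice's premise is never met (numbers: 8 + 6 + 10 + 9 = 33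
orbits, residual unions `[7], ∅, [7], [7]`). These are the in-sample levels of the cell's T-BS13 cells; none of `11, 13, 19, 29`
carries a pseudo-solution `±ℓ^m ± 1 = c²`, `±ℓ^m ± 8 = c²`, `±8ℓ^m ± 1 = c²`. WHAT THIS IS NOT: the conjecture's content lives at
levels WITH survivors (the pseudo-solution levels `ℓ ∈ {3, 5, 17, 37, 41}` among the twelve held files `2⁵ℓ`, `ℓ ≤ 41`, and the
census levels `ℓ ≥ 43`); there the conclusion `CongruentToFrey` quantifies over ALL primes and is not decidable from finite orbit
data, so no slice with a survivor is provable (or refutable) from a level file — this file is silent about them. The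
content-bearing levels of the registered test «E2-LR32-R2» (below) are those five pseudo-solution levels and the out-of-sample
survivor-free levels `ℓ ∈ {7, 23, 31}` (`224, 736, 992`), whose level files are NOT in the tree; the four slices proved here are
VACUOUS INSTANCES (premise never met) at in-sample levels (lead g17 TOKEN «L2-INSTANCES GO», HOME/INBOX 2026-08-27T04:19:31Z). Context: the
registered instrument test «E2-LR32-R2» of the typed law on the twelve held files (HOME/lead/PREDICTIONS-ODDHALVES-lead-g14.md
registrar l.81, 2026-08-27T03:57:30Z; engine-2 g28, second hand engine-1 g19) — this file is the kernel face of that test at the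
four of the twelve levels whose certified level files are in the tree. Nothing here is a claim on ABC or any summit.

References: [BS04] M. A. Bennett, C. M. Skinner, Canad. J. Math. 56 (2004) 23–54, Lemma 4.2, Prop. 4.3; A. Kraus, Canad. J. Math. 49
(1997) 1139–1161. Cell records: HOME = run/shared/lean/pub/pub-abcsig/: STRUCTURE.md §6 CONJ-LR32, lead/CONJ-LEAN-SPEC.md,
census/levels-sturm/ (N352, N416, N608, N928 engine-1 files + C5PRIME-LEDGER).
-/

namespace Summit.Ventures.AbcSig.Conjectures

open Summit.Ventures.AbcSig

/-! ## The level slice of the conjecture -/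

/-- **The level-`2⁵ℓ` slice of `CONJ_LR32_L2`**: the conjecture's statement at one prime `ℓ` (all exponents `n ≥ 17`, `n ≠ ℓ`,
outside level raising `¬ n ∣ (ℓ + 1)² − a_ℓ(32a)²`; all newforms of level `2⁵ℓ`; all Kraus classes). A CONJECTURE SLICE, not a
theorem in general; `CONJ_LR32_L2 M ↔ ∀ ℓ prime ≥ 3, CONJ_LR32_L2At M ℓ` (`CONJ_LR32_L2_iff`). MEANINGFUL ONLY FOR THE INTENDED
MODEL, like every statement over `NewformModel`. -/
def CONJ_LR32_L2At (M : NewformModel) (ℓ : ℕ) : Prop :=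
  ∀ n : ℕ, n.Prime → 17 ≤ n → n ≠ ℓ → ¬ LevelRaise a32 ℓ n →
    ∀ f : M.Form (2 ^ 5 * ℓ), ∀ κ ∈ lr32Classes ℓ n, M.ArisesMod f n (lr32ClassAllowed ℓ n κ) →
      ∃ (S : FreyDatum) (m : ℕ), S.n = n ∧ S.C = 1 ∧ 1 ≤ m ∧ Nat.Coprime S.A S.B ∧
        IsPrimitiveSolution S.A S.B 1 n S.a S.b S.c ∧
        ((S.A * S.B = ℓ ^ m ∧ CongruentToFrey M f n .E1 S) ∨
          (S.A * S.B = 2 ^ 3 * ℓ ^ m ∧ CongruentToFrey M f n .E2 S))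

/-- `CONJ_LR32_L2` is the conjunction of its level slices over the primes `ℓ ≥ 3` (bookkeeping; by definition). -/
theorem CONJ_LR32_L2_iff (M : NewformModel) : CONJ_LR32_L2 M ↔ ∀ ℓ : ℕ, ℓ.Prime → 3 ≤ ℓ → CONJ_LR32_L2At M ℓ :=
  ⟨fun h ℓ hℓ h3 n => h ℓ n hℓ h3, fun h ℓ n hℓ h3 => h ℓ hℓ h3 n⟩

/-! ## The slice premise refines the coarse premise -/

/-- Every entry of a class table `lr32ClassAllowed ℓ n κ q` (`κ` a Kraus class of the level-`2⁵ℓ` families, `ℓ` prime, `n ≥ 4`,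
`q` an odd prime) lies in the coarse list `bs04Allowed q`: away from the auxiliary primes the two lists coincide, and at an
auxiliary prime `q ≡ 1 (mod n)`, `q ≠ ℓ` (so `q ≥ 5`, `q ∤ B ∈ {1, 8, ℓ^m, 8ℓ^m}`, `C = 1`) this is
`krausTable_subset_bs04Allowed`. -/
theorem lr32ClassAllowed_subset_bs04Allowed {ℓ n : ℕ} (hℓ : ℓ.Prime) (hn : 4 ≤ n) {κ : FreyModel × ℕ × ℕ}
    (hκ : κ ∈ lr32Classes ℓ n) {q : ℕ} (hq : q.Prime) (hq2 : q ≠ 2) :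
    ∀ t ∈ lr32ClassAllowed ℓ n κ q, t ∈ bs04Allowed q := by
  intro t ht
  unfold lr32ClassAllowed at ht
  split_ifs at ht with haux
  · obtain ⟨-, hqn, hqℓ⟩ := haux
    have hq3 : q ≠ 3 := by
      rintro rfl
      rw [Nat.mod_eq_of_lt (by omega : 3 < n)] at hqn
      omega
    have hqℓpow : ∀ j : ℕ, ¬ q ∣ ℓ ^ j := fun j h =>
      hqℓ ((Nat.prime_dvd_prime_iff_eq hq hℓ).mp (hq.dvd_of_dvd_pow h))
    have hq8 : ¬ q ∣ 8 := fun h => hq2 ((Nat.prime_dvd_prime_iff_eq hq Nat.prime_two).mp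
      (hq.dvd_of_dvd_pow (show q ∣ 2 ^ 3 by simpa using h)))
    simp only [lr32Classes, List.mem_flatMap, List.mem_range, List.mem_cons, List.not_mem_nil, or_false] at hκ
    obtain ⟨j, -, hj⟩ := hκ
    have hC : ¬ q ∣ (1 : ℕ) := by
      rw [Nat.dvd_one]
      exact hq.one_lt.ne'
    rcases hj with rfl | rfl | rfl | rfl
    · exact krausTable_subset_bs04Allowed _ hq hq2 hq3 (hqℓpow _) hC t ht
    · exact krausTable_subset_bs04Allowed _ hq hq2 hq3 hC hC t ht
    · refine krausTable_subset_bs04Allowed _ hq hq2 hq3 (fun h => ?_) hC t ht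
      rcases (Nat.Prime.dvd_mul hq).mp h with h | h
      · exact hq8 h
      · exact hqℓpow _ h
    · exact krausTable_subset_bs04Allowed _ hq hq2 hq3 hq8 hC t ht
  · exact ht

/-- **The slice premise implies the coarse premise**: a newform passing one Kraus class table of the level-`2⁵ℓ` families
(and the coarse sets elsewhere) modulo a prime above `n` passes the coarse [BS04, Lemma 4.2] sets modulo that prime. -/
theorem arisesMod_bs04_of_lr32ClassAllowed (M : NewformModel) {N ℓ n : ℕ} (hℓ : ℓ.Prime) (hn : 4 ≤ n) (f : M.Form N)
    {κ : FreyModel × ℕ × ℕ} (hκ : κ ∈ lr32Classes ℓ n) (h : M.ArisesMod f n (lr32ClassAllowed ℓ n κ)) :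
    M.ArisesMod f n bs04Allowed :=
  M.arisesMod_mono f n (fun _ hq hq2 _ _ => lr32ClassAllowed_subset_bs04Allowed hℓ hn hκ hq hq2) h

/-- **A slice holds (vacuously) where the coarse sieve leaves nothing.** If the newforms of level `2⁵ℓ` are among the listed
orbit data (computed hypothesis `DataComplete`), every listed entry is at an odd prime not dividing the level, and every listed
orbit is sieve-eliminated for the coarse sets at every prime `n ≥ 17`, `n ≠ ℓ`, then `CONJ_LR32_L2At M ℓ`: its premise is never
met (`NewformModel.not_arisesMod_of_eliminated` after `arisesMod_bs04_of_lr32ClassAllowed`). -/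
theorem CONJ_LR32_L2At_of_eliminated (M : NewformModel) {ℓ : ℕ} (hℓ : ℓ.Prime) {orbits : List OrbitData}
    (hD : M.DataComplete (2 ^ 5 * ℓ) orbits)
    (hgood : ∀ o ∈ orbits, ∀ e ∈ o.coeffs, e.ell.Prime ∧ e.ell ≠ 2 ∧ ¬ e.ell ∣ 2 ^ 5 * ℓ)
    (helim : ∀ n : ℕ, n.Prime → 17 ≤ n → n ≠ ℓ → ∀ o ∈ orbits, o.Eliminated bs04Allowed n) :
    CONJ_LR32_L2At M ℓ := by
  intro n hn h17 hnℓ _ f κ hκ hA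
  obtain ⟨o, ho, hfo⟩ := hD f
  exact absurd (arisesMod_bs04_of_lr32ClassAllowed M hℓ (by omega) f hκ hA)
    (M.not_arisesMod_of_eliminated f o hfo n bs04Allowed (helim n hn h17 hnℓ o ho) (hgood o ho))

/-! ## The four slices whose certified level files are in the tree -/

/-- **`CONJ_LR32_L2` at `ℓ = 11` (level `352 = 2⁵·11`) holds in every model whose level-352 newforms are the 8 certified orbits
of `Levels/N352.lean`** (computed hypothesis `DataComplete`; residual exponents of the kernel certificates `⊆ {7}`, so at every
prime `n ≥ 17` no newform passes the coarse sieve — vacuous instance). -/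
theorem CONJ_LR32_L2At_11 (M : NewformModel) (hD : M.DataComplete 352 level352Orbits) : CONJ_LR32_L2At M 11 :=
  CONJ_LR32_L2At_of_eliminated M (by norm_num) hD level352_wellformed fun n hn h17 _ o ho =>
    ((level352_sieve n hn (by omega) (fun _ => False)
      (fun h => by simp only [List.mem_cons, List.not_mem_nil, or_false] at h; omega)
      (fun h => by simp only [List.mem_cons, List.not_mem_nil, or_false] at h; omega) o ho).2).elim id False.elim

/-- **`CONJ_LR32_L2` at `ℓ = 13` (level `416 = 2⁵·13`) holds in every model whose level-416 newforms are the 6 certified orbits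
of `Levels/N416.lean`** (computed hypothesis `DataComplete`; every orbit is sieve-eliminated at every prime `n ≥ 7` — vacuous
instance). -/
theorem CONJ_LR32_L2At_13 (M : NewformModel) (hD : M.DataComplete 416 level416Orbits) : CONJ_LR32_L2At M 13 :=
  CONJ_LR32_L2At_of_eliminated M (by norm_num) hD level416_wellformed fun n hn h17 _ o ho =>
    ((level416_sieve n hn (by omega) (fun _ => False) o ho).2).elim id False.elim

/-- **`CONJ_LR32_L2` at `ℓ = 19` (level `608 = 2⁵·19`) holds in every model whose level-608 newforms are the 10 certified
orbits of `Levels/N608.lean`** (computed hypothesis `DataComplete`; residual exponents `⊆ {7}` — vacuous instance). -/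
theorem CONJ_LR32_L2At_19 (M : NewformModel) (hD : M.DataComplete 608 level608Orbits) : CONJ_LR32_L2At M 19 :=
  CONJ_LR32_L2At_of_eliminated M (by norm_num) hD level608_wellformed fun n hn h17 _ o ho =>
    ((level608_sieve n hn (by omega) (fun _ => False)
      (fun h => by simp only [List.mem_cons, List.not_mem_nil, or_false] at h; omega)
      (fun h => by simp only [List.mem_cons, List.not_mem_nil, or_false] at h; omega)
      (fun h => by simp only [List.mem_cons, List.not_mem_nil, or_false] at h; omega)
      (fun h => by simp only [List.mem_cons, List.not_mem_nil, or_false] at h; omega)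
      (fun h => by simp only [List.mem_cons, List.not_mem_nil, or_false] at h; omega)
      (fun h => by simp only [List.mem_cons, List.not_mem_nil, or_false] at h; omega) o ho).2).elim id False.elim

/-- **`CONJ_LR32_L2` at `ℓ = 29` (level `928 = 2⁵·29`) holds in every model whose level-928 newforms are the 9 certified orbits
of `Levels/N928.lean`** (computed hypothesis `DataComplete`; residual exponents `⊆ {7}` — vacuous instance). -/
theorem CONJ_LR32_L2At_29 (M : NewformModel) (hD : M.DataComplete 928 level928Orbits) : CONJ_LR32_L2At M 29 :=
  CONJ_LR32_L2At_of_eliminated M (by norm_num) hD level928_wellformed fun n hn h17 _ o ho =>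
    ((level928_sieve n hn (by omega) (fun _ => False)
      (fun h => by simp only [List.mem_cons, List.not_mem_nil, or_false] at h; omega)
      (fun h => by simp only [List.mem_cons, List.not_mem_nil, or_false] at h; omega) o ho).2).elim id False.elim

end Summit.Ventures.AbcSig.Conjectures
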